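import Summits.CriticalPhenomena.SAWScalingLimit.Theorems.ObservableToSLER.Negative.NotRootRenewalDomain

/-!
# Crux `ObservableToSLER` (stmt-CriticalPhenomena-14005): `RootRenewal` is false — part 2, the forced U-profile, existence of a walk, and `not_rootRenewal`

Negative lemma (refuter, cdisprove cycle 2); see part 1 (`NotRootRenewalDomain`) for the forcing
domain `Lam K N` and its clauses.  Here: `forcedU` (every mid-edge SAW of `Lam K N` from the source
`s(fj 1 1, fj 0 1)` to the target `s(fj jD 0, fj (jD+1) (−1))` visits the top row `H ≥ 2^K` and
then ends at row `0` — the last index outside the lower down column is adjacent to it, hence on the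
top row by the coordinate lemma `row_eq_Ht_of_adj_DownLow`), `nonempty_saw` (a reachability path
inside `Λ ∖ {fj 1 1}` converted into a `HexMidEdgeSAW`), and **`not_rootRenewal`**: the sketch's
`RootRenewal` (written out verbatim, inline) is false — instantiate at `ε = 1/2`, `d = 1`,
`Λ = Lam K ⌈R₀⌉₊`, `m = 0` and conclude by `rootRenewal_conclusion_false`
(`Negative.RootRenewalDefects`).  MORAL for planners: a renewal/bridge abundance input may not be
"uniform in the far lattice geometry" — far geometry can force every walk above any window and
back; admissible forms are per fixed Dobrushin domain, eventually in `δ` (card 3's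
`RenewalAccumulation` shape). [folklore]
-/

noncomputable section

open Literature.Probability.RandomPlanarGeometry Literature.Probability.RandomPlanarGeometry.SAW
  Literature.Probability.LatticeModels
open scoped Classical

namespace Summit.CriticalPhenomena.SAWScalingLimit.Theorems.ObservableToSLER.Negative

namespace RootRenewalDefects

open Summit.CriticalPhenomena.SAWScalingLimit.Theorems.BoundaryClosure.Negative

section Instance

variable {K N : ℕ}

/-! ### The forced U-profile -/

/-- The lower part of the down column. [folklore] -/
def DownLow (K N : ℕ) (v : HexVertex) : Prop := InDown K N (jOf v) (rOf v) ∧ rOf v < Ht K N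

/-- **Neighbour lemma**: a vertex of `Λ` outside the lower down column but adjacent to it lies on
the top row. [folklore] -/
theorem row_eq_Ht_of_adj_DownLow {v v' : HexVertex} (hv' : v' ∈ Lam K N) (hnd : ¬ DownLow K N v')
    (hv : DownLow K N v) (hadj : hexGraph.Adj v' v) : rOf v' = Ht K N := by
  rw [← fj_jOf_rOf v, ← fj_jOf_rOf v'] at hadj
  rw [mem_Lam_iff] at hv'
  unfold DownLow at hnd hv
  generalize jOf v = j at *
  generalize rOf v = r at *
  generalize jOf v' = j' at *
  generalize rOf v' = r' at *
  rw [adj_fj_iff] at hadj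
  have h2K := @one_le_two_pow K
  unfold InLam InBox InTop InDown jD Ht at *
  omega

/-- **Every walk of the forcing domain from the source mid-edge to the target mid-edge passes the
top row (row `Ht ≥ 2^K`) and then ends at the foot of the down column (row `0`).** [folklore] -/
theorem forcedU (γ : HexMidEdgeSAW (Lam K N) s(uF, wF) (zF N)) :
    ∃ i j : ℕ, ∃ hij : i < j, ∃ hj : j < γ.verts.length,
      (0 : ℤ) + 2 ^ K * ((1 : ℕ) : ℤ) ≤ row (γ.verts[i]'(hij.trans hj)) ∧
        row (γ.verts[j]) ≤ (0 : ℤ) + ((1 : ℕ) : ℤ) := by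
  set l := γ.verts with hl
  have hne : l ≠ [] := fun h => a_ne_zF (γ.eq_of_nil h)
  have hlen : 0 < l.length := List.length_pos_of_ne_nil hne
  -- the last vertex is the foot `yF`
  have hlast : l.getLast hne = yF N := by
    have h1 : l.getLast hne ∈ zF N := γ.getLast_mem _ (List.getLast?_eq_some_getLast hne)
    have h2 : l.getLast hne ∈ Lam K N := γ.subset _ (List.getLast_mem hne)
    unfold zF at h1
    rcases Sym2.mem_iff.1 h1 with h | h
    · exact h
    · exact absurd (h ▸ h2) yF'_not_mem
  have hlastD : DownLow K N (l.getLast hne) := by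
    rw [hlast]; unfold DownLow yF; rw [jOf_fj, rOf_fj]
    have h2K := @one_le_two_pow K
    unfold InDown Ht; omega
  -- the first vertex is `uF` or `wF`, not in the lower down column
  have hfirst : ¬ DownLow K N (l[0]'hlen) := by
    have h0 : l[0]'hlen ∈ s(uF, wF) := γ.head_mem _ (by rw [List.head?_eq_getElem?, List.getElem?_eq_getElem hlen])
    unfold DownLow
    rcases Sym2.mem_iff.1 h0 with h | h <;> rw [h]
    · unfold uF; rw [jOf_fj, rOf_fj]; exact fun hh => uF_not_InDown hh.1
    · unfold wF; rw [jOf_fj, rOf_fj]; exact fun hh => wF_not_InDown hh.1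
  -- the last index outside the lower down column
  set Q : ℕ → Prop := fun t => ∃ v, l[t]? = some v ∧ ¬ DownLow K N v with hQ
  set t₀ := Nat.findGreatest Q (l.length - 1) with ht₀
  have hQ0 : Q 0 := ⟨l[0]'hlen, (List.getElem?_eq_getElem hlen), hfirst⟩
  have hQt₀ : Q t₀ := Nat.findGreatest_spec (P := Q) (Nat.zero_le _) hQ0
  have ht₀le : t₀ ≤ l.length - 1 := Nat.findGreatest_le _
  have hnotQlast : ¬ Q (l.length - 1) := by
    rintro ⟨v, hv, hvD⟩
    rw [List.getElem?_eq_getElem (by omega), Option.some_inj] at hv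
    rw [← hv, ← List.getLast_eq_getElem hne] at hvD
    exact hvD hlastD
  have ht₀lt : t₀ < l.length - 1 := by
    rcases ht₀le.lt_or_eq with h | h
    · exact h
    · exact absurd (h ▸ hQt₀) hnotQlast
  have hnotQ : ¬ Q (t₀ + 1) :=
    Nat.findGreatest_is_greatest (P := Q) (Nat.lt_succ_self _) (by omega)
  obtain ⟨v₀, hv₀, hv₀D⟩ := hQt₀
  have ht₀len : t₀ < l.length := by omega
  have ht₁len : t₀ + 1 < l.length := by omega
  rw [List.getElem?_eq_getElem ht₀len, Option.some_inj] at hv₀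
  have hv₁D : DownLow K N (l[t₀ + 1]) := by
    by_contra hc
    exact hnotQ ⟨l[t₀ + 1], List.getElem?_eq_getElem ht₁len, hc⟩
  have hadj : hexGraph.Adj (l[t₀]) (l[t₀ + 1]) := γ.isChain.getElem t₀ ht₁len
  have hrow : rOf (l[t₀]) = Ht K N :=
    row_eq_Ht_of_adj_DownLow (γ.subset _ (List.getElem_mem ht₀len)) (hv₀ ▸ hv₀D) hv₁D hadj
  refine ⟨t₀, l.length - 1, ht₀lt, by omega, ?_, ?_⟩
  · show (0 : ℤ) + 2 ^ K * ((1 : ℕ) : ℤ) ≤ (l[t₀]).1 1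
    have : (l[t₀]).1 1 = rOf (l[t₀]) := rfl
    rw [this, hrow]; unfold Ht; push_cast; omega
  · show (l[l.length - 1]).1 1 ≤ (0 : ℤ) + ((1 : ℕ) : ℤ)
    rw [← List.getLast_eq_getElem hne, hlast]
    unfold yF; rw [fj_fst_one]; norm_num

/-! ### A walk exists: reachability inside `Λ ∖ {u}` and its conversion to a mid-edge SAW -/

/-- The vertex set `Λ ∖ {u}`. [folklore] -/
def LamU (K N : ℕ) : Set HexVertex := {v | v ∈ Lam K N ∧ v ≠ uF}

/-- Coordinate faces of `Λ` other than `u` lie in `Λ ∖ {u}`. [folklore] -/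
theorem fj_mem_LamU {j r : ℤ} (h : InLam K N j r) (hu : ¬ (j = 1 ∧ r = 1)) : fj j r ∈ LamU K N := by
  refine ⟨fj_mem_Lam_iff.2 h, fun e => hu ?_⟩
  unfold uF at e
  exact fj_inj.1 e

/-- `w` is joined to the foot `yF` inside `Λ ∖ {u}`. [folklore] -/
theorem rch_wF_yF : (wF, yF N) ∈ RchRel (LamU K N) := by
  have h2K := @one_le_two_pow K
  have hBox : ∀ j r : ℤ, 0 ≤ r → r ≤ Ht K N - 1 → -(4 * N : ℤ) - 2 ≤ j → j ≤ 2 * N + 2 →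
      ¬ (j = 1 ∧ r = 1) → fj j r ∈ LamU K N :=
    fun j r h1 h2 h3 h4 hu => fj_mem_LamU (Or.inl ⟨h1, h2, h3, h4⟩) hu
  have hTop : ∀ j : ℤ, -(4 * N : ℤ) - 2 ≤ j → j ≤ jD N + 1 → fj j (Ht K N) ∈ LamU K N :=
    fun j h1 h2 => fj_mem_LamU (Or.inr (Or.inl ⟨rfl, h1, h2⟩)) (by unfold Ht; omega)
  have hDown : ∀ j r : ℤ, 0 ≤ r → r ≤ Ht K N → (j = jD N ∨ j = jD N + 1) → fj j r ∈ LamU K N :=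
    fun j r h1 h2 h3 => fj_mem_LamU (Or.inr (Or.inr ⟨h1, h2, h3⟩)) (by unfold jD at h3; omega)
  -- w = (0,1) → (-1,1)
  have s1 : (fj 0 1, fj (-1) 1) ∈ RchRel (LamU K N) :=
    rch_symm (rch_of_adj (hBox _ _ (by norm_num) (by unfold Ht; omega) (by omega) (by omega) (by omega))
      (hBox _ _ (by norm_num) (by unfold Ht; omega) (by omega) (by omega) (by omega))
      (by have := adj_fj_succ (-1) 1; simpa using this))
  -- (-1,1) up to (-1, Ht-1)
  obtain ⟨n, hn⟩ : ∃ n : ℕ, (n : ℤ) = Ht K N - 2 := ⟨(Ht K N - 2).toNat, by unfold Ht; omega⟩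
  have s2 : (fj (-1) 1, fj (-1) (1 + n)) ∈ RchRel (LamU K N) :=
    rch_col_up (LamU K N) (by norm_num) 1 n
      (hBox _ _ (by norm_num) (by unfold Ht; omega) (by omega) (by omega) (by omega))
      fun i hi hi' => ⟨hBox _ _ (by omega) (by omega) (by omega) (by omega) (by omega),
        hBox _ _ (by omega) (by omega) (by omega) (by omega) (by omega)⟩
  rw [hn, show (1 : ℤ) + (Ht K N - 2) = Ht K N - 1 by ring] at s2
  -- (-1, Ht-1) → (-2, Ht)
  have s3 : (fj (-1) (Ht K N - 1), fj (-2) (Ht K N)) ∈ RchRel (LamU K N) :=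
    rch_of_adj (hBox _ _ (by unfold Ht; omega) le_rfl (by omega) (by omega) (by unfold Ht; omega))
      (hTop _ (by omega) (by unfold jD; omega))
      (by have := adj_fj_up (j := -1) (by norm_num) (Ht K N - 1)
          simpa [sub_add_cancel] using this)
  -- along the top row to (jD, Ht)
  have s4 : (fj (-2) (Ht K N), fj (jD N) (Ht K N)) ∈ RchRel (LamU K N) :=
    rch_row (LamU K N) (Ht K N) (-2) (jD N) (by unfold jD; omega) fun i hi hi' =>
      hTop i (by omega) (by omega)
  -- down the column to (jD, 0)
  obtain ⟨n', hn'⟩ : ∃ n' : ℕ, (n' : ℤ) = Ht K N := ⟨(Ht K N).toNat, by unfold Ht; omega⟩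
  have s5 : (fj (jD N) (Ht K N), fj (jD N) (Ht K N - n')) ∈ RchRel (LamU K N) :=
    rch_col_down (LamU K N) jD_even (Ht K N) n' (hDown _ _ (by unfold Ht; omega) le_rfl (Or.inl rfl))
      fun i hi hi' => ⟨hDown _ _ (by omega) (by omega) (Or.inl rfl),
        hDown _ _ (by omega) (by omega) (Or.inr rfl)⟩
  rw [hn', sub_self] at s5
  exact rch_trans (rch_trans (rch_trans (rch_trans s1 s2) s3) s4) s5

/-- **A mid-edge SAW from the source to the target exists.** [folklore] -/
theorem nonempty_saw : Nonempty (HexMidEdgeSAW (Lam K N) s(uF, wF) (zF N)) := by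
  obtain ⟨hw, hy, ⟨p⟩⟩ := rch_wF_yF (K := K) (N := N)
  set q := p.toPath with hq
  set l : List HexVertex := q.1.support.map Subtype.val with hl
  have hlS : ∀ v ∈ l, v ∈ LamU K N := by
    intro v hv
    obtain ⟨x, -, rfl⟩ := List.mem_map.1 hv
    exact x.2
  have hnd : l.Nodup := (q.2.support_nodup).map Subtype.val_injective
  have hch : l.IsChain hexGraph.Adj := by
    rw [hl, List.isChain_map]
    exact (q.1.isChain_adj_support).imp fun a b h => h
  have hne : l ≠ [] := by rw [hl]; simp
  have hhead : l.head? = some wF := by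
    rw [hl, ← SimpleGraph.Walk.cons_tail_support]; rfl
  have hlast : l.getLast? = some (yF N) := by
    rw [hl, List.getLast?_map, List.getLast?_eq_some_getLast (SimpleGraph.Walk.support_ne_nil _),
      Option.map_some, SimpleGraph.Walk.getLast_support]
  have hu : uF ∉ l := fun h => (hlS _ h).2 rfl
  have hy' : yF' N ∉ l := fun h => yF'_not_mem (hlS _ h).1
  set E := List.zipWith (fun u w => s(u, w)) l l.tail with hE
  have haE : s(uF, wF) ∉ E := fun h => hu (forall_mem_of_mem_edges l _ h uF (Sym2.mem_mk_left _ _))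
  have hzE : zF N ∉ E := fun h =>
    hy' (forall_mem_of_mem_edges l _ h (yF' N) (by unfold zF; exact Sym2.mem_mk_right _ _))
  refine ⟨{ verts := l
            subset := fun v hv => (hlS v hv).1
            nodup := hnd
            isChain := hch
            head_mem := fun v hv => ?_
            getLast_mem := fun v hv => ?_
            eq_of_nil := fun h => (hne h).elim
            edges_nodup := fun _ => ?_
            fst_mem := a_mem_midEdges }⟩
  · rw [hhead, Option.some_inj] at hv
    subst hv
    exact Sym2.mem_mk_right _ _
  · rw [hlast, Option.some_inj] at hv
    rw [← hv]; unfold zF; exact Sym2.mem_mk_left _ _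
  · have hEn : E.Nodup := edges_nodup hnd
    refine List.nodup_append.2 ⟨List.nodup_cons.2 ⟨haE, hEn⟩, List.nodup_singleton _, ?_⟩
    intro e he f hf
    rw [List.mem_singleton] at hf
    subst hf
    rcases List.mem_cons.1 he with rfl | he
    · exact a_ne_zF
    · rintro rfl; exact hzE he

/-! ### `RootRenewal` is false -/

/-- **`RootRenewal` — the typed a-priori input of crux idea `root-renewal-kesten`, here written out VERBATIM (the sketch's `def RootRenewal : Prop`, with `row`, `noRenewalObs`, `Z` of `Negative.RootRenewalDefects`) — IS FALSE.** [folklore] -/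
theorem not_rootRenewal :
    ¬ (∀ ε : ℝ, 0 < ε → ∃ K : ℕ, ∀ d : ℕ, 1 ≤ d → ∃ R₀ : ℝ, 0 < R₀ ∧
        ∀ (Λ : Finset HexVertex) (m : ℤ) (u w : HexVertex) (z : Sym2 HexVertex),
          hexDomainSimplyConnected Λ → hexGraph.Adj u w → w ∈ Λ → row w = m + d →
          (∀ v : HexVertex, dist (hexCenter v) (hexCenter w) ≤ R₀ → (v ∈ Λ ↔ m ≤ row v)) →
          z ∈ hexDomainMidEdges Λ → (∀ v ∈ z, R₀ ≤ dist (hexCenter v) (hexCenter w)) →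
            (noRenewalObs Λ s(u, w) z hexCriticalFugacity 0 (m + d) (m + 2 ^ K * d)).re
              ≤ ε * Z Λ s(u, w) z) := by
  intro h
  obtain ⟨K, hK⟩ := h (1 / 2) (by norm_num)
  obtain ⟨R₀, hR₀, H⟩ := hK 1 le_rfl
  set N : ℕ := ⌈R₀⌉₊ with hN
  have hRN : R₀ ≤ N := Nat.le_ceil R₀
  have := H (Lam K N) 0 uF wF (zF N) simplyConnected_Lam adj_uF_wF wF_mem row_wF
    (fun v hv => patch_clause hRN v hv) zF_mem_midEdges (fun v hv => far_clause hRN v hv)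
  exact rootRenewal_conclusion_false (m := 0) (d := 1) (K := K) forcedU nonempty_saw
    (by norm_num : (1 / 2 : ℝ) < 1) this

end Instance

end RootRenewalDefects

end Summit.CriticalPhenomena.SAWScalingLimit.Theorems.ObservableToSLER.Negative
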